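/- Copyright: the b2b-balaban cell (near-miss cell 7), T⁴-continuum fan-out; row NE7b CRUX team (2), OWNER seat
t4-ne7b-p1 (gen 54) — INTERFACE REQUEST NE7b IR-54-1 «(α)-JOINT», item (J3c): THE JOINT WITNESS — the terminal theorem
of record APPLIED with every binder discharged.  Released under the licence of the surrounding project. -/
import Summits.QuantumFields.BalabanUV.T4Continuum.Support.HistoryRealiseCellsRunAssemblyWTVSJointRecord
import Summits.QuantumFields.BalabanUV.T4Continuum.Support.HistoryRealiseCellsRunAssemblyWTVSJointDatum
import Summits.QuantumFields.BalabanUV.T4Continuum.Support.HistoryRealiseCellsRunAssemblyWTVSJointLetters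

/-!
# (α)-JOINT, part 4: THE JOINT WITNESS — `continuumYM4Torus_of_histReadingLWL_fsc` APPLIED TO THE JOINT DATUM WITH EVERY
ONE OF ITS BINDERS DISCHARGED (INTERFACE REQUEST NE7b IR-54-1 (J3c); owner lineage `t4-ne7b-p1` gen 54)

Summits-side support leaf of the T⁴-continuum cell (rung (B)+1 on a FINITE torus only; NOT infinite volume, NOT the
mass gap, NOT Clay; NOT a proof of NE7b — the cell's OWN estimate, NOT PRINTED, NOT PROVED).  [decided toy] over parts
1 (`JointLetters`: `Cj`, `Lj`, the letter-level binders), 2 (`JointDatum`: `jointData F : FiniteEpsData F SU(1)` with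
(B) ∧ `BetaPertHyp` ∧ `IsBlockAveraged`), 3a∕3b (`JointReading`∕`JointRecord`: `flowRows_of_tuned`, `histReadDataLWL₅`)
and leaf-05's toy suppliers (`toyR`, `ZD`, `Isk`, `μ₀`, `shell_toyR`, `budget_toyR`), REUSED BY NAME; one `def` (the
family `Fj`), nothing printed asserted, no `def … : Prop` fact, no cite-tagged hypothesis, zero `sorry`.

WHY (owner item (α)-JOINT, journal `CLAIMS.log` l.36187; IR-54-1, `HOME/INBOX.md` l.18285).  The terminal theorem of
record of row NE7b's (α) road, `HistoryRealiseCellsRunAssemblyWTVSLWLP82.continuumYM4Torus_of_histReadingLWL_fsc`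
(p303949), had NO instance on the tree: every inhabitation of its record was on `toyData`, where its binder `hB` FAILS.
Whether its ≈ 30 outside binders, the record's 122 fields, and the prefix `ForSmallCouplings` (non-vacuous only on a
datum WITH tuned bare sequences, i.e. with a RUNNING flow) are JOINTLY satisfiable was undecided.  THIS FILE decides it
POSITIVELY: the theorem is applied, and Lean checks every binder.

WHAT.  §1 on the joint datum: the dressed generating function of EVERY loop string at EVERY cutoff is `e^t`
(`ZD_jointData`; the one-point group makes every loop variable `1`), so leaf-05's NE7 ∕ NE7c sockets are met EXACTLY for
every string (`budget_toyR` at class constant `ν ≡ 0`, `shell_toyR`), the envelope is `e`, the (γ) floor is `1`, the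
site budget `0`.  §2 **`histReadDataLWL_jointData`**: the lattice-unit record on the joint datum along ANY bare sequence
whose runs carry part 3a's seven flow rows, for every loop string, at `(Cj, O₁)`, `rr = d = n = 1`, `θᵥ = 1∕8`,
`cΛ = M = Lr = Φ = 0`, `b₀ = 1∕Lj`, census `(6, 3, 4, 6, 1, 8)`; **`forSmallCouplings_histReadDataLWL_jointData`**: the
terminal's `hRead` ON THE JOINT DATUM — for all small `γ`, EVERY bare sequence tuned within `]0, γ]` (such sequences
EXIST: `exists_tuned_jointData`) and EVERY loop string, the record is inhabited (flow rows by `flowRows_of_tuned` from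
`BetaPertHyp`).  §3 `Fj : T4Family` (`L := Lj = 87781`, `m := 1`) and **THE JOINT WITNESS
`continuumYM4Torus_jointData : ContinuumYM4Torus (jointData Fj)` PROVED BY `continuumYM4Torus_of_histReadingLWL_fsc`**
with `hBA hE hB hβ hsign` from part 2, `ThresholdOK` + the seventeen letter binders from part 1 (`thresholdOK_Cj`,
`joint_outside_Cj`), and `hRead` from §2; **`continuumYM4TorusE_jointData`**: the ∃-form too (tuned sequences exist AND
carry the limit) — the conclusion is NOT obtained from an empty `ForSmallCouplings` range.

HONEST.  THE CERTIFIED SENTENCE: «the hypothesis set of the (α) road's terminal theorem of record — (B), `BetaPertHyp`,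
`IsBlockAveraged`, `SignConventions`, `ThresholdOK`, the seventeen letter binders, and the 122-field record
`HistReadDataLWL` for every tuned bare sequence and every loop string — is JOINTLY SATISFIABLE, on a datum whose
`ForSmallCouplings` range is non-empty».  NOTHING MORE: the datum is the degenerate one-point theory `SU(1)` (no field,
no action, no large field; (B) holds because its form-clause is abstract and (2.50) degenerates to `1 ≤ 1 ≤ 1`; the
record's H3-side fields are VACUOUS on the no-region reading; the NE7 ∕ NE7c sockets hold because every generating
function is `e^t`); `ContinuumYM4Torus (jointData Fj)` is in any case immediate for a theory whose every expectation is
`1` — the content is the ROUTE, not the conclusion.  Nothing of Bałaban's is discharged, valued or asserted; every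
R-class row of the wall (`HistRead`, M1's `Holds`, `FactorRead`, (ρ0)(ρ1)(ρ2), (γ), `hΛL`) stays where it is for real
data; ρ = cΛ∕c_{E₂} UNVALUED; NE7b NOT PRINTED ∕ NOT PROVED; spine 0∕9.  HONEST DEPENDENCY (cell): continuum YM on T⁴ ⇐
BetaPertH ∧ nine spine estimates (0/9 proved); BetaPertH ⇐ (D1) ∧ (D4) ∧ CAP+tail; G-an2-4 gates asym, D1 and NE2/3/4.
Unchanged here.
-/

open Finset MeasureTheory
open Literature.MathematicalPhysics.QuantumFieldTheory.Balaban1983to89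
open Literature.MathematicalPhysics.QuantumFieldTheory.Balaban1983to89.B16SProfile (DropCtl)
open Literature.MathematicalPhysics.QuantumFieldTheory.Balaban1983to89.T4ContinuumYM4Torus
open T4PersistenceDictionary T4PersistentHistoryCount T4BankedInduction T4PrintedShapeBanking
open T4WeightBudget T4GlobalDenominator T4LiveClassFibration T4LiveStructureGas T4LiveGasToTerms T4RecordPriceSeam
open T4PartnerMultiplicity T4IndicatorShell T4MatchingAssembly T4MatchingClosure T4MatchingClosureSocket T4Continuum
open T4StabilitySocket T4BranchingRecordsGas T4TaggedShapeBanking T4CanonicalMenus T4RenewalChains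
open Summit.QuantumFields.BalabanUV.T4Continuum.HistoryFlow Summit.QuantumFields.BalabanUV.T4Continuum.HistoryGen
open Summit.QuantumFields.BalabanUV.T4Continuum.HistoryGenealogyRealise
open Summit.QuantumFields.BalabanUV.T4Continuum.HistoryAssemblyRealiseRun
open Summit.QuantumFields.BalabanUV.T4Continuum.HistoryRealiseCellsRunApexT3bWTVS
open Summit.QuantumFields.BalabanUV.T4Continuum.B16HistoryIndexedRepr
open Summit.QuantumFields.BalabanUV.T4Continuum.B16HistoryIndexedTrunc
open Summit.QuantumFields.BalabanUV.T4Continuum.HistoryConstants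
open Summit.QuantumFields.BalabanUV.T4Continuum.HistoryRealiseCellsRunAssemblyWTVSDataLWL
open Summit.QuantumFields.BalabanUV.T4Continuum.HistoryRealiseCellsRunAssemblyWTVSLWLP82
open Summit.QuantumFields.BalabanUV.T4Continuum.HistoryRealiseCellsRunAssemblyWTVSSanity
open Summit.QuantumFields.BalabanUV.T4Continuum.HistoryRealiseCellsRunAssemblyWTVSJointReading
open Summit.QuantumFields.BalabanUV.T4Continuum.HistoryRealiseCellsRunAssemblyWTVSJointRecord
open Summit.QuantumFields.BalabanUV.T4Continuum.HistoryRealiseCellsRunAssemblyWTVSJointDatum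
open Summit.QuantumFields.BalabanUV.T4Continuum.HistoryRealiseCellsRunAssemblyWTVSJointLetters
open Summit.QuantumFields.BalabanUV.T4Continuum.CountThresholdUniform (ThresholdOK)
open Summit.QuantumFields.BalabanUV.T4Continuum.HistoryBankingSharpShares (ell)
open Summit.QuantumFields.BalabanUV.T4Continuum.HistoryBankingVolumeWindowLattice (uvolL)

namespace Summit.QuantumFields.BalabanUV.T4Continuum.HistoryRealiseCellsRunAssemblyWTVSJointWitness

noncomputable section

-- the structural `DecidableEq` instance of the concrete tag type exceeds the default synthesis size (as in the siblings)
set_option synthInstance.maxSize 1024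

open B16HistoryIndexedRepr.Sanity B16HistoryIndexedRepr.SanityInput HistoryConstants.Sanity

/-! ## §1 The joint datum's dressed generating functions, envelopes, floors -/

section Datum

variable (F : T4Family)

/-- **EVERY DRESSED GENERATING FUNCTION OF THE JOINT DATUM IS `e^t`** — every loop string, every cutoff, every bare
sequence (the product observable is `1`, the density is `1`, product Haar measure is a probability). [decided toy] -/
@[simp] theorem ZD_jointData (g₀ : ℕ → ℝ) (os : List (ULoop F)) (K : ℕ) (t : ℝ) :
    ZD (jointData F) g₀ os K t = Real.exp t := by
  unfold ZD
  rw [integral_unique_prob]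
  simp

/-- hence positive [decided toy] -/
theorem ZD_jointData_pos (g₀ : ℕ → ℝ) (os : List (ULoop F)) (K : ℕ) (t : ℝ) : 0 < ZD (jointData F) g₀ os K t := by
  rw [ZD_jointData]; exact Real.exp_pos t

/-- the K-uniform envelope on the source disc: `e^t ≤ e` for `|t| ≤ 1` [decided toy] -/
theorem ZD_jointData_le (g₀ : ℕ → ℝ) (os : List (ULoop F)) :
    ∀ K t, |t| ≤ 1 → ZD (jointData F) g₀ os K t ≤ Real.exp 1 := fun K t ht => by
  rw [ZD_jointData]
  exact Real.exp_le_exp.mpr (le_trans (le_abs_self t) ht)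

/-- the two runs' generating functions differ by the `t`-FREE factor `e^0` (NE7's socket input, EXACT on the datum for
EVERY string) [decided toy] -/
theorem ZD_jointData_succ (g₀ : ℕ → ℝ) (os : List (ULoop F)) :
    ∀ K t, |t| ≤ 1 → ZD (jointData F) g₀ os (K + 1) t = Real.exp ((fun _ => (0 : ℝ)) K) * ZD (jointData F) g₀ os K t :=
  fun K t _ => by simp

end Datum

/-! ## §2 The lattice-unit record on the joint datum along runs carrying the flow rows; the terminal's `hRead` -/

section Record

variable (F : T4Family)

/-- **`HistReadDataLWL` ON THE JOINT DATUM** for a bare sequence `g₀` whose runs carry part 3a's seven flow rows with sizes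
`R` at `(β′, b₀)`, for EVERY loop string `os`, at `(Cj, O₁)`, `rr = d = n = 1`, `θᵥ := 1∕8`, `cΛ = M = Lr = Φ := 0`,
census `(p₁, η, η′, κ, κ₂, κᵥ) = (6, 3, 4, 6, 1, 8)` — part 3b's `histReadDataLWL₅` with every remaining input discharged
on the datum (§1; (γ) floor `1`, sites `0`, NE7c∕NE7 sockets by leaf-05's `shell_toyR`∕`budget_toyR` at `ν ≡ 0`).
[decided toy] -/
def histReadDataLWL_jointData {b₀ : ℝ} (hb₀ : 0 ≤ b₀) (β' : ℝ) (g₀ : ℕ → ℝ) (os : List (ULoop F)) (R : ℕ → ℕ → ℕ)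
    (isRj : ∀ K s, s ≤ K → B14.IsRj F.L 1 (((jointData F).C ⟨K, F.m, g₀ K⟩).flow.g s) (R K s))
    (hR2 : ∀ K t, 2 ≤ R K t)
    (h27 : ∀ K, B14.FlowIneq27 ((jointData F).C ⟨K, F.m, g₀ K⟩).flow.g β' b₀ 1 K)
    (h29 : ∀ K, B14FlowStep.FlowIneq29 (R K) ((jointData F).C ⟨K, F.m, g₀ K⟩).flow.g F.L β' b₀ K)
    (hprof : ∀ K t, t < K → runProfile F.L R K (t + 1) ≤ runProfile F.L R K t)
    (hdrop : ∀ K m, DropCtl (runProfile F.L R K) m)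
    (hx1 : ∀ K s, s ≤ K → 1 ≤ Real.log ((((jointData F).C ⟨K, F.m, g₀ K⟩).flow.g s) ^ 2)⁻¹) :
    HistReadDataLWL (jointData F) Cj O₁ (1 / 8) 1 1 1 one_pos g₀ os 0 0 0 0 b₀ 6 3 4 6 1 8 Isk Isk (fun _ => Unit) μ₀
      (fun _ => GoodClass.top Unit) (fun _ => Unit) μ₀ (fun _ => GoodClass.top Unit) :=
  histReadDataLWL₅ (jointData F) (avgMeasurable_jointData F) (C := Cj) (O := O₁) (by norm_num) (by norm_num)
    (by norm_num) (by norm_num) (by norm_num) (by norm_num [O₁]) (by norm_num [O₁]) (by norm_num [O₁])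
    (by norm_num [O₁]) (by norm_num) 1 1 one_pos g₀ os R hR2 le_rfl le_rfl le_rfl le_rfl hb₀ β' le_rfl
    (by decide) (by decide) (by decide) (by decide) (by decide) (by decide) (by norm_num) (by norm_num) (by norm_num)
    le_rfl (by norm_num) (ZD_jointData_le F g₀ os) isRj
    (fun K t => one_le_lamVolL le_rfl le_rfl (fun j hj => hx1 K j hj) t) h27 h29 hprof hdrop (c₀ := 1) (n₁ := 0)
    one_pos (fun K => (smallFieldMass_jointData F K _).symm.le) (fun K => (smallFieldMass_jointData F (K + 1) _).symm.le)
    (fun K => by simp) (fun K => by simp) (shell_toyR _)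
    (budget_toyR (fun K t _ => ZD_jointData_pos F g₀ os K t) _ (ZD_jointData_succ F g₀ os) _)
    summable_zero summable_zero summable_zero summable_zero

/-- **THE TERMINAL's `hRead` ON THE JOINT DATUM**: for all small `γ`, EVERY bare sequence tuned within `]0, γ]` (such
sequences EXIST on this datum: `exists_tuned_jointData`) and EVERY loop string, the lattice-unit record is inhabited —
with the flow rows supplied by part 3a's `flowRows_of_tuned` from `BetaPertHyp` at `b₀ := 1∕F.L`. [decided toy] -/
theorem forSmallCouplings_histReadDataLWL_jointData :
    ForSmallCouplings (jointData F) fun g₀ => ∀ os : List (ULoop F),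
      ∃ (DomK : ℕ → Type) (I : (K : ℕ) → HIndex (DomK K)) (_ : DecidableEq (HIndex.Idx I)) (DomK' : ℕ → Type)
        (I' : (K : ℕ) → HIndex (DomK' K)) (X : ℕ → Type) (_ : ∀ K, MeasurableSpace (X K))
        (μ : (K : ℕ) → Measure (X K)) (_ : ∀ K, IsFiniteMeasure (μ K)) (𝒢 : (K : ℕ) → GoodClass (X K))
        (Y : ℕ → Type) (_ : ∀ K, MeasurableSpace (Y K)) (νB : (K : ℕ) → Measure (Y K))
        (_ : ∀ K, IsFiniteMeasure (νB K)) (𝒢' : (K : ℕ) → GoodClass (Y K)),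
        Nonempty (HistReadDataLWL (jointData F) Cj O₁ (1 / 8) 1 1 1 one_pos g₀ os 0 0 0 0 (1 / (F.L : ℝ))
          6 3 4 6 1 8 I I' X μ 𝒢 Y νB 𝒢') := by
  have hL : (2 : ℝ) ≤ F.L := by exact_mod_cast two_le_L F
  have hb₀ : (0 : ℝ) < 1 / (F.L : ℝ) := by positivity
  have hb₁ : 1 / (F.L : ℝ) ≤ 1 / 2 := one_div_le_one_div_of_le (by norm_num) hL
  have hLb : (F.L : ℝ) * (1 / (F.L : ℝ)) ≤ 1 := by rw [mul_one_div_cancel (by linarith)]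
  obtain ⟨γ₁, hγ₁, β', hflow⟩ := flowRows_of_tuned (jointData F) (betaPertHyp_jointData F) hb₀ hb₁ hLb (rr := 1) le_rfl
  refine ⟨γ₁, hγ₁, fun γ hγ hγle => ⟨1, one_pos, fun g _ _ g₀ ht os => ?_⟩⟩
  obtain ⟨R, hR, hR2, h27, h29, hprof, hdrop, hx1⟩ := hflow γ hγ hγle g g₀ ht
  exact ⟨_, Isk, inferInstance, _, Isk, fun _ => Unit, inferInstance, μ₀, inferInstance, _, fun _ => Unit,
    inferInstance, μ₀, inferInstance, _,
    ⟨histReadDataLWL_jointData F hb₀.le β' g₀ os R hR hR2 h27 h29 hprof hdrop hx1⟩⟩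

end Record

/-! ## §3 The joint witness -/

/-- **THE JOINT FAMILY**: blocking parameter `L := Lj = 87781` (odd, `> 11`), torus exponent `m := 1`. [decided toy] -/
def Fj : T4Family := ⟨Lj, Lj_admissible.1, Lj_admissible.2, 1, le_rfl⟩

/-- its blocking parameter is `Lj` [decided toy] -/
@[simp] theorem Fj_L : Fj.L = Lj := rfl

/-- **THE JOINT WITNESS.**  `continuumYM4Torus_of_histReadingLWL_fsc` — the terminal theorem of record of row NE7b's
(α) road (p303949) — APPLIED to the joint datum `jointData Fj` over `SU(1)` with EVERY binder discharged: `hBA`, `hE`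
(trivial small-loop average, `measurableE_trivial`), `hB` (`endStatementBPrinted_jointData`), `hβ`
(`betaPertHyp_jointData`), `hsign`; `ThresholdOK Cj Lj 1 (1∕Lj)` and the seventeen letter binders (part 1, at `d = n = 1`,
`θ = θᵥ = 1∕8`, `sS = 2`, `θc = 3∕4`); and `hRead` (§2).  Lean checks the whole antecedent: IT IS JOINTLY SATISFIABLE,
with a non-empty `ForSmallCouplings` range (`exists_tuned_jointData`, and the ∃-form below). [decided toy] -/
theorem continuumYM4Torus_jointData : ContinuumYM4Torus (jointData Fj) := by
  obtain ⟨hμ, hκ₁, hE₀, hA₀, hβ₀, hLβ, hn₁, hn, hθ, hslack, hE₂, hE₃, hsS, hsmall, hθc0, hθc1, hθcs⟩ := joint_outside_Cj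
  exact continuumYM4Torus_of_histReadingLWL_fsc (jointData Fj) (isBlockAveraged_jointData Fj)
    LoopAverage.measurableE_trivial (endStatementBPrinted_jointData Fj) (betaPertHyp_jointData Fj)
    (signConventions_jointData Fj) thresholdOK_Cj hμ 1 1 hκ₁ hE₀ hA₀ hβ₀ hLβ hn₁ hn hθ hslack hE₂ hE₃ hsS hsmall hθc0
    hθc1 hθcs (forSmallCouplings_histReadDataLWL_jointData Fj)

/-- **… AND THE ∃-FORM**: for all small `γ`, `g` SOME bare sequence tuned to `g` within `]0, γ]` EXISTS on the joint datum
and carries the full limit with agreeing, reflection-positive, covariant limit points — the witness's `ForSmallCouplings`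
range is NOT empty (`T4ContinuumYM4Torus.continuumYM4TorusE_of_betaPertHyp`). [decided toy] -/
theorem continuumYM4TorusE_jointData : ContinuumYM4TorusE (jointData Fj) :=
  continuumYM4TorusE_of_betaPertHyp (betaPertHyp_jointData Fj) continuumYM4Torus_jointData

/-- THE CERTIFICATE IN ONE LINE: both readings on the joint datum. [decided toy] -/
theorem jointWitness : ContinuumYM4Torus (jointData Fj) ∧ ContinuumYM4TorusE (jointData Fj) :=
  ⟨continuumYM4Torus_jointData, continuumYM4TorusE_jointData⟩

end

end Summit.QuantumFields.BalabanUV.T4Continuum.HistoryRealiseCellsRunAssemblyWTVSJointWitness
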